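import Mathlib
import Literature.Topology.FourManifolds.SimplifiedBrokenLefschetzFibration
import HarnessLib

/-!
# The indefinite fold `(t, x₁, x₂, x₃) ↦ (t, x₁² + x₂² - x₃²)`: local model and critical set

Topic `Literature/Topology/FourManifolds`.  The real normal form of an INDEFINITE FOLD point of a
smooth map from a 4-manifold to a surface (Baykur–Saeki 2017, §2.1, p. 6: *"fold singularity …
`(t, x₁, x₂, x₃) ↦ (t, ±x₁² ± x₂² ± x₃²)`"*, indefinite = mixed signs; Hayano 2011, Def. 2.1 (4)),
in exactly the shape used by the `fold` clause of the tree's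
`Literature.Topology.FourManifolds.IsSimplifiedBrokenLefschetzFibration`
(`(ψ (f q)) 0 = (φ q) 0 ∧ (ψ (f q)) 1 = (φ q) 1 ^ 2 + (φ q) 2 ^ 2 - (φ q) 3 ^ 2` in smooth charts
`φ`, `ψ`).  Everything in this file is PROVED; no named fact is introduced.  It is the first brick
of the verification layer that any proof of the existence theorem
`exists_isSimplifiedBrokenLefschetzFibration` (Baykur–Saeki 2017, Thm. 6.1 / Cor. 6.2) — and any
proof of the Euler count / genus-one classification facts of
`SimplifiedBrokenLefschetzFibration.lean` — has to pass through: the critical set of a map near a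
round (fold) point.

## Main definitions and results

* `indefiniteFoldMap : ℝ⁴ → ℝ²`, `(t, x₁, x₂, x₃) ↦ (t, x₁² + x₂² - x₃²)`, and its derivative
  `indefiniteFoldDeriv x : ℝ⁴ →L[ℝ] ℝ²`, `v ↦ (v₀, 2x₁v₁ + 2x₂v₂ - 2x₃v₃)`
  (`hasFDerivAt_indefiniteFoldMap`, `contDiff_indefiniteFoldMap`).
* `surjective_indefiniteFoldDeriv_iff`: **the differential of the fold is onto iff
  `(x₁, x₂, x₃) ≠ 0`** — the critical set of the model is the `t`-axis.
* `surjective_mfderiv_iff_of_foldChart`: **chart transport** — if `f : X → B` (any `C^∞`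
  4-manifold `X`, any surface `B` modelled on `ℝ²`) is the fold in smooth charts `φ` of `X` and
  `ψ` of `B` on `φ.source` (the data of the `fold` clause), then for `q ∈ φ.source` the
  differential `mfderiv (𝓡 4) (𝓡 2) f q` is onto iff `((φ q)₁, (φ q)₂, (φ q)₃) ≠ 0`; hence
  (`injOn_of_foldChart`) `f` is injective on the critical points inside `φ.source`, and
  (`IsSimplifiedBrokenLefschetzFibration.exists_foldChart_not_surjective_iff`) every round point
  of an SBLF has a chart in which the round locus is exactly the `t`-axis.

## References

* R. İ. Baykur, O. Saeki, *Simplifying indefinite fibrations on 4-manifolds*, arXiv:1705.11169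
  (Trans. AMS 376, 2023), §2.1. [BaykurSaeki2017]
* K. Hayano, *On genus-1 simplified broken Lefschetz fibrations*, Algebr. Geom. Topol. 11 (2011),
  Def. 2.1. [Hayano2011]
-/

noncomputable section

open scoped Manifold ContDiff Topology
open Set Function

namespace Literature.Topology.FourManifolds

/-- Local notation: `𝔼 n` is the model Euclidean space `EuclideanSpace ℝ (Fin n)`. -/
local notation "𝔼 " n:arg => EuclideanSpace ℝ (Fin n)

/-! ### The model map and its derivative -/

/-- **The indefinite fold** `ℝ⁴ → ℝ²`, `(t, x₁, x₂, x₃) ↦ (t, x₁² + x₂² - x₃²)` (coordinates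
`x 0 = t`, `x 1, x 2, x 3`): the local model of a round (indefinite fold) singular point of a map
from a 4-manifold to a surface (Baykur–Saeki 2017, §2.1; Hayano 2011, Def. 2.1 (4)).
[cite: BaykurSaeki2017, §2.1] -/
def indefiniteFoldMap (x : 𝔼 4) : 𝔼 2 :=
  (x 0) • EuclideanSpace.single (0 : Fin 2) (1 : ℝ) +
    (x 1 ^ 2 + x 2 ^ 2 - x 3 ^ 2) • EuclideanSpace.single (1 : Fin 2) (1 : ℝ)

/-- First component of the fold: `t`. [folklore] -/
@[simp] theorem indefiniteFoldMap_apply_zero (x : 𝔼 4) : indefiniteFoldMap x 0 = x 0 := by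
  simp [indefiniteFoldMap]

/-- Second component of the fold: the quadratic form `x₁² + x₂² - x₃²` of signature `(2, 1)`.
[folklore] -/
@[simp] theorem indefiniteFoldMap_apply_one (x : 𝔼 4) :
    indefiniteFoldMap x 1 = x 1 ^ 2 + x 2 ^ 2 - x 3 ^ 2 := by
  simp [indefiniteFoldMap]

/-- A point of `ℝ²` in the shape of the `fold` clause of `IsSimplifiedBrokenLefschetzFibration`
(`y 0 = x 0`, `y 1 = x 1 ^ 2 + x 2 ^ 2 - x 3 ^ 2`) IS the value of the fold model. [folklore] -/
theorem eq_indefiniteFoldMap_of_apply {x : 𝔼 4} {y : 𝔼 2} (h0 : y 0 = x 0)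
    (h1 : y 1 = x 1 ^ 2 + x 2 ^ 2 - x 3 ^ 2) : y = indefiniteFoldMap x := by
  ext i
  fin_cases i
  · simpa using h0
  · simpa using h1

/-- The fold model is smooth (a polynomial map). [folklore] -/
theorem contDiff_indefiniteFoldMap : ContDiff ℝ ∞ indefiniteFoldMap := by
  have hc : ∀ i : Fin 4, ContDiff ℝ ∞ fun x : 𝔼 4 => x i := fun i =>
    (EuclideanSpace.proj i : 𝔼 4 →L[ℝ] ℝ).contDiff
  unfold indefiniteFoldMap
  exact ((hc 0).smul contDiff_const).add
    (((((hc 1).pow 2).add ((hc 2).pow 2)).sub ((hc 3).pow 2)).smul contDiff_const)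

/-- **The derivative of the fold** at `x`: the continuous linear map
`v ↦ (v₀, 2x₁v₁ + 2x₂v₂ - 2x₃v₃)`. [folklore] -/
def indefiniteFoldDeriv (x : 𝔼 4) : 𝔼 4 →L[ℝ] 𝔼 2 :=
  (EuclideanSpace.proj (0 : Fin 4) : 𝔼 4 →L[ℝ] ℝ).smulRight
      (EuclideanSpace.single (0 : Fin 2) (1 : ℝ)) +
    ((2 * x 1) • (EuclideanSpace.proj (1 : Fin 4) : 𝔼 4 →L[ℝ] ℝ) +
        (2 * x 2) • (EuclideanSpace.proj (2 : Fin 4) : 𝔼 4 →L[ℝ] ℝ) -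
        (2 * x 3) • (EuclideanSpace.proj (3 : Fin 4) : 𝔼 4 →L[ℝ] ℝ)).smulRight
      (EuclideanSpace.single (1 : Fin 2) (1 : ℝ))

/-- First component of the fold derivative: `(dF_x v)₀ = v₀`. [folklore] -/
@[simp] theorem indefiniteFoldDeriv_apply_zero (x v : 𝔼 4) : indefiniteFoldDeriv x v 0 = v 0 := by
  simp [indefiniteFoldDeriv, ContinuousLinearMap.smulRight_apply]

/-- Second component of the fold derivative: `(dF_x v)₁ = 2x₁v₁ + 2x₂v₂ - 2x₃v₃`. [folklore] -/
@[simp] theorem indefiniteFoldDeriv_apply_one (x v : 𝔼 4) :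
    indefiniteFoldDeriv x v 1 = 2 * x 1 * v 1 + 2 * x 2 * v 2 - 2 * x 3 * v 3 := by
  simp [indefiniteFoldDeriv, ContinuousLinearMap.smulRight_apply]

/-- **The fold has derivative `indefiniteFoldDeriv x` at `x`** (product/chain rule on the
coordinate functions, which are continuous linear). [folklore] -/
theorem hasFDerivAt_indefiniteFoldMap (x : 𝔼 4) :
    HasFDerivAt indefiniteFoldMap (indefiniteFoldDeriv x) x := by
  have hc : ∀ i : Fin 4, HasFDerivAt (fun x : 𝔼 4 => x i)
      (EuclideanSpace.proj i : 𝔼 4 →L[ℝ] ℝ) x := fun i =>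
    (EuclideanSpace.proj i : 𝔼 4 →L[ℝ] ℝ).hasFDerivAt
  have hq : HasFDerivAt (fun x : 𝔼 4 => x 1 ^ 2 + x 2 ^ 2 - x 3 ^ 2)
      ((2 * x 1) • (EuclideanSpace.proj (1 : Fin 4) : 𝔼 4 →L[ℝ] ℝ) +
        (2 * x 2) • (EuclideanSpace.proj (2 : Fin 4) : 𝔼 4 →L[ℝ] ℝ) -
        (2 * x 3) • (EuclideanSpace.proj (3 : Fin 4) : 𝔼 4 →L[ℝ] ℝ)) x := by
    refine ((((hc 1).pow 2).add ((hc 2).pow 2)).sub ((hc 3).pow 2)).congr_fderiv ?_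
    ext v
    simp
  exact ((hc 0).smul_const _).add (hq.smul_const _)

/-- `fderiv` form of `hasFDerivAt_indefiniteFoldMap`. [folklore] -/
theorem fderiv_indefiniteFoldMap (x : 𝔼 4) :
    fderiv ℝ indefiniteFoldMap x = indefiniteFoldDeriv x :=
  (hasFDerivAt_indefiniteFoldMap x).fderiv

/-! ### The critical set of the model is the `t`-axis -/

/-- **The differential of the fold is onto iff `(x₁, x₂, x₃) ≠ 0`.**  If `x₁ = x₂ = x₃ = 0` the
second row of `dF_x` vanishes, so `(0, 1)` is not a value; if some `xᵢ ≠ 0` (`i = 1, 2, 3`) then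
`(a, b) = dF_x (a e₀ + (b / (±2xᵢ)) eᵢ)`.  Hence the critical set of the fold model is the
`t`-axis `{x₁ = x₂ = x₃ = 0}` (Baykur–Saeki 2017, §2.1: the fold locus is 1-dimensional).
[folklore] -/
theorem surjective_indefiniteFoldDeriv_iff (x : 𝔼 4) :
    Surjective (indefiniteFoldDeriv x) ↔ ¬ (x 1 = 0 ∧ x 2 = 0 ∧ x 3 = 0) := by
  constructor
  · rintro hs ⟨h1, h2, h3⟩
    obtain ⟨v, hv⟩ := hs (EuclideanSpace.single (1 : Fin 2) (1 : ℝ))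
    have h := congrArg (fun w : 𝔼 2 => w 1) hv
    simp [h1, h2, h3] at h
  · intro hx w
    -- `w = dF_x (w₀ e₀ + (w₁ / (±2xᵢ)) eᵢ)` for a coordinate `i ∈ {1, 2, 3}` with `xᵢ ≠ 0`
    by_cases h1 : x 1 = 0
    · by_cases h2 : x 2 = 0
      · have h3 : x 3 ≠ 0 := fun h3 => hx ⟨h1, h2, h3⟩
        refine ⟨w 0 • EuclideanSpace.single (0 : Fin 4) (1 : ℝ) +
          (-(w 1 / (2 * x 3))) • EuclideanSpace.single (3 : Fin 4) (1 : ℝ), ?_⟩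
        ext i
        fin_cases i
        · simp
        · simp [h1, h2]
          field_simp
      · refine ⟨w 0 • EuclideanSpace.single (0 : Fin 4) (1 : ℝ) +
          (w 1 / (2 * x 2)) • EuclideanSpace.single (2 : Fin 4) (1 : ℝ), ?_⟩
        ext i
        fin_cases i
        · simp
        · simp [h1]
          field_simp
    · refine ⟨w 0 • EuclideanSpace.single (0 : Fin 4) (1 : ℝ) +
        (w 1 / (2 * x 1)) • EuclideanSpace.single (1 : Fin 4) (1 : ℝ), ?_⟩
      ext i
      fin_cases i
      · simp
      · simp
        field_simp

/-- `fderiv` form: the differential of the fold model at `x` is onto iff `(x₁, x₂, x₃) ≠ 0`.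
[folklore] -/
theorem surjective_fderiv_indefiniteFoldMap_iff (x : 𝔼 4) :
    Surjective (fderiv ℝ indefiniteFoldMap x) ↔ ¬ (x 1 = 0 ∧ x 2 = 0 ∧ x 3 = 0) := by
  rw [fderiv_indefiniteFoldMap, surjective_indefiniteFoldDeriv_iff]

/-- **The fold model is injective on its critical set**: a critical point `x` (so
`x₁ = x₂ = x₃ = 0`) is determined by its value, indeed by `(F x)₀ = x₀`. [folklore] -/
theorem eq_of_indefiniteFoldMap_eq {x x' : 𝔼 4} (hx : x 1 = 0 ∧ x 2 = 0 ∧ x 3 = 0)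
    (hx' : x' 1 = 0 ∧ x' 2 = 0 ∧ x' 3 = 0) (h : indefiniteFoldMap x = indefiniteFoldMap x') :
    x = x' := by
  have h0 : x 0 = x' 0 := by simpa using congrArg (fun w : 𝔼 2 => w 0) h
  ext i
  fin_cases i
  · simpa using h0
  · simp [hx.1, hx'.1]
  · simp [hx.2.1, hx'.2.1]
  · simp [hx.2.2, hx'.2.2]

/-! ### Chart transport: the critical set of a map with a fold chart -/

section Transport

variable {X : Type*} [TopologicalSpace X] [ChartedSpace (EuclideanSpace ℝ (Fin 4)) X]
  {B : Type*} [TopologicalSpace B] [ChartedSpace (EuclideanSpace ℝ (Fin 2)) B]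
  {f : X → B} {φ : OpenPartialHomeomorph X (𝔼 4)} {ψ : OpenPartialHomeomorph B (𝔼 2)}

omit [ChartedSpace (EuclideanSpace ℝ (Fin 4)) X] [ChartedSpace (EuclideanSpace ℝ (Fin 2)) B] in
/-- In a fold chart, `ψ ∘ f = F ∘ φ` on `φ.source` with `F` the fold model: the `fold`-clause
identities packaged. [folklore] -/
theorem apply_eq_indefiniteFoldMap_of_foldChart
    (hmodel : ∀ q ∈ φ.source,
      (ψ (f q)) 0 = (φ q) 0 ∧ (ψ (f q)) 1 = (φ q) 1 ^ 2 + (φ q) 2 ^ 2 - (φ q) 3 ^ 2)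
    {q : X} (hq : q ∈ φ.source) : ψ (f q) = indefiniteFoldMap (φ q) :=
  eq_indefiniteFoldMap_of_apply (hmodel q hq).1 (hmodel q hq).2

omit [ChartedSpace (EuclideanSpace ℝ (Fin 4)) X] [ChartedSpace (EuclideanSpace ℝ (Fin 2)) B] in
/-- In a fold chart, `f = ψ⁻¹ ∘ F ∘ φ` near every point of `φ.source`. [folklore] -/
theorem eventuallyEq_of_foldChart (hmaps : MapsTo f φ.source ψ.source)
    (hmodel : ∀ q ∈ φ.source,
      (ψ (f q)) 0 = (φ q) 0 ∧ (ψ (f q)) 1 = (φ q) 1 ^ 2 + (φ q) 2 ^ 2 - (φ q) 3 ^ 2)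
    {q : X} (hq : q ∈ φ.source) : f =ᶠ[𝓝 q] (ψ.symm ∘ indefiniteFoldMap ∘ φ) := by
  filter_upwards [φ.open_source.mem_nhds hq] with y hy
  show f y = ψ.symm (indefiniteFoldMap (φ y))
  rw [← apply_eq_indefiniteFoldMap_of_foldChart hmodel hy, ψ.left_inv (hmaps hy)]

/-- **Chart transport of the critical set.**  Let `f : X → B` be the indefinite fold in smooth
charts `φ` of the 4-manifold `X` (valued in `ℝ⁴`, smooth with smooth inverse) and `ψ` of the
surface `B` (valued in `ℝ²`, smooth with smooth inverse) on `φ.source` — precisely the data of the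
`fold` clause of `IsSimplifiedBrokenLefschetzFibration`.  Then for `q ∈ φ.source` the
differential `df_q` is onto iff `((φ q)₁, (φ q)₂, (φ q)₃) ≠ 0`: by the chain rule
`df_q = d(ψ⁻¹) ∘ dF_{φ q} ∘ dφ_q` with the outer factors invertible
(`OpenPartialHomeomorph.MDifferentiable.mfderiv_bijective`), and `dF` is onto exactly off the
`t`-axis (`surjective_indefiniteFoldDeriv_iff`).  So the critical points of `f` in `φ.source` are
`φ⁻¹` of the `t`-axis (Baykur–Saeki 2017, §2.1; Hayano 2011, Def. 2.1 (4)). [folklore] -/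
theorem surjective_mfderiv_iff_of_foldChart (hmaps : MapsTo f φ.source ψ.source)
    (hφ : ContMDiffOn (𝓡 4) (𝓡 4) ∞ φ φ.source) (hφs : ContMDiffOn (𝓡 4) (𝓡 4) ∞ φ.symm φ.target)
    (hψ : ContMDiffOn (𝓡 2) (𝓡 2) ∞ ψ ψ.source) (hψs : ContMDiffOn (𝓡 2) (𝓡 2) ∞ ψ.symm ψ.target)
    (hmodel : ∀ q ∈ φ.source,
      (ψ (f q)) 0 = (φ q) 0 ∧ (ψ (f q)) 1 = (φ q) 1 ^ 2 + (φ q) 2 ^ 2 - (φ q) 3 ^ 2)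
    {q : X} (hq : q ∈ φ.source) :
    Surjective (mfderiv (𝓡 4) (𝓡 2) f q) ↔ ¬ ((φ q) 1 = 0 ∧ (φ q) 2 = 0 ∧ (φ q) 3 = 0) := by
  have hφmd : φ.MDifferentiable (𝓡 4) (𝓡 4) :=
    ⟨hφ.mdifferentiableOn (by simp), hφs.mdifferentiableOn (by simp)⟩
  have hψmd : ψ.MDifferentiable (𝓡 2) (𝓡 2) :=
    ⟨hψ.mdifferentiableOn (by simp), hψs.mdifferentiableOn (by simp)⟩
  have hyt : indefiniteFoldMap (φ q) ∈ ψ.target := by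
    rw [← apply_eq_indefiniteFoldMap_of_foldChart hmodel hq]
    exact ψ.map_source (hmaps hq)
  have hF : HasMFDerivAt (𝓡 4) (𝓡 2) indefiniteFoldMap (φ q) (indefiniteFoldDeriv (φ q)) :=
    (hasFDerivAt_indefiniteFoldMap (φ q)).hasMFDerivAt
  have hφq : HasMFDerivAt (𝓡 4) (𝓡 4) φ q (mfderiv (𝓡 4) (𝓡 4) φ q) :=
    (hφmd.mdifferentiableAt hq).hasMFDerivAt
  have hψq : HasMFDerivAt (𝓡 2) (𝓡 2) ψ.symm (indefiniteFoldMap (φ q))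
      (mfderiv (𝓡 2) (𝓡 2) ψ.symm (indefiniteFoldMap (φ q))) :=
    (hψmd.mdifferentiableAt_symm hyt).hasMFDerivAt
  have hcomp := hψq.comp q (hF.comp q hφq)
  have key : ⇑(mfderiv (𝓡 4) (𝓡 2) f q) =
      ⇑(mfderiv (𝓡 2) (𝓡 2) ψ.symm (indefiniteFoldMap (φ q))) ∘ ⇑(indefiniteFoldDeriv (φ q)) ∘
        ⇑(mfderiv (𝓡 4) (𝓡 4) φ q) := by
    rw [(eventuallyEq_of_foldChart hmaps hmodel hq).mfderiv_eq, hcomp.mfderiv]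
    rfl
  rw [key]
  have hA := hψmd.symm.mfderiv_bijective hyt
  have hC := hφmd.mfderiv_surjective hq
  refine Iff.trans ⟨fun hs => ?_, fun hD => ?_⟩ (surjective_indefiniteFoldDeriv_iff (φ q))
  · exact (hs.of_comp_left hA.1).of_comp
  · exact hA.2.comp (hD.comp hC)

/-- **A map is injective on the critical points of a fold chart**: if `q, q' ∈ φ.source` are
critical points of `f` with `f q = f q'` then `q = q'` (both chart images lie on the `t`-axis,
and `t = (ψ (f q))₀`).  This is the local half of "embedded round image" for any map built from
fold charts. [folklore] -/
theorem injOn_of_foldChart (hmaps : MapsTo f φ.source ψ.source)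
    (hφ : ContMDiffOn (𝓡 4) (𝓡 4) ∞ φ φ.source) (hφs : ContMDiffOn (𝓡 4) (𝓡 4) ∞ φ.symm φ.target)
    (hψ : ContMDiffOn (𝓡 2) (𝓡 2) ∞ ψ ψ.source) (hψs : ContMDiffOn (𝓡 2) (𝓡 2) ∞ ψ.symm ψ.target)
    (hmodel : ∀ q ∈ φ.source,
      (ψ (f q)) 0 = (φ q) 0 ∧ (ψ (f q)) 1 = (φ q) 1 ^ 2 + (φ q) 2 ^ 2 - (φ q) 3 ^ 2) :
    InjOn f (φ.source ∩ {q | ¬ Surjective (mfderiv (𝓡 4) (𝓡 2) f q)}) := by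
  rintro q ⟨hq, hqc⟩ q' ⟨hq', hqc'⟩ hqq'
  rw [mem_setOf_eq, surjective_mfderiv_iff_of_foldChart hmaps hφ hφs hψ hψs hmodel ‹_›,
    not_not] at hqc hqc'
  have h : indefiniteFoldMap (φ q) = indefiniteFoldMap (φ q') := by
    rw [← apply_eq_indefiniteFoldMap_of_foldChart hmodel hq,
      ← apply_eq_indefiniteFoldMap_of_foldChart hmodel hq', hqq']
  exact φ.injOn hq hq' (eq_of_indefiniteFoldMap_eq hqc hqc' h)

/-- **The critical points in a fold chart are `φ⁻¹` of the `t`-axis** (set form of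
`surjective_mfderiv_iff_of_foldChart`). [folklore] -/
theorem inter_setOf_not_surjective_eq_of_foldChart (hmaps : MapsTo f φ.source ψ.source)
    (hφ : ContMDiffOn (𝓡 4) (𝓡 4) ∞ φ φ.source) (hφs : ContMDiffOn (𝓡 4) (𝓡 4) ∞ φ.symm φ.target)
    (hψ : ContMDiffOn (𝓡 2) (𝓡 2) ∞ ψ ψ.source) (hψs : ContMDiffOn (𝓡 2) (𝓡 2) ∞ ψ.symm ψ.target)
    (hmodel : ∀ q ∈ φ.source,
      (ψ (f q)) 0 = (φ q) 0 ∧ (ψ (f q)) 1 = (φ q) 1 ^ 2 + (φ q) 2 ^ 2 - (φ q) 3 ^ 2) :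
    φ.source ∩ {q | ¬ Surjective (mfderiv (𝓡 4) (𝓡 2) f q)} =
      φ.source ∩ φ ⁻¹' {x | x 1 = 0 ∧ x 2 = 0 ∧ x 3 = 0} := by
  ext q
  simp only [mem_inter_iff, mem_setOf_eq, mem_preimage]
  constructor
  · rintro ⟨hq, hqc⟩
    exact ⟨hq, not_not.mp
      (mt (surjective_mfderiv_iff_of_foldChart hmaps hφ hφs hψ hψs hmodel hq).mpr hqc)⟩
  · rintro ⟨hq, hqc⟩
    exact ⟨hq, fun h =>
      (surjective_mfderiv_iff_of_foldChart hmaps hφ hφs hψ hψs hmodel hq).mp h hqc⟩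

end Transport

/-! ### Round points of a simplified broken Lefschetz fibration -/

namespace IsSimplifiedBrokenLefschetzFibration

universe u

variable {X : Type u} [TopologicalSpace X] [ChartedSpace (EuclideanSpace ℝ (Fin 4)) X]
  [IsManifold (𝓡 4) 1 X] {o : SmoothOrientation (𝓡 4) X}
  {f : X → Metric.sphere (0 : EuclideanSpace ℝ (Fin 3)) 1} {L : Finset X} {h : ℕ}

/-- **Near a round point of an SBLF the critical set is an arc**: every critical point `p ∉ L`
of a simplified broken Lefschetz fibration has a smooth chart `φ` centred at `p` (valued in
`ℝ⁴`, smooth with smooth inverse) in which the critical points of `f` inside `φ.source` are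
exactly `φ⁻¹` of the `t`-axis, and `f` is injective on them (the `fold` clause read through
`surjective_mfderiv_iff_of_foldChart`; Hayano 2011, Def. 2.1 (4): the round locus `Z` is a
1-dimensional submanifold). [folklore] -/
theorem exists_foldChart_not_surjective_iff (hf : IsSimplifiedBrokenLefschetzFibration o f L h)
    {p : X} (hp : ¬ Surjective (mfderiv (𝓡 4) (𝓡 2) f p)) (hpL : p ∉ L) :
    ∃ φ : OpenPartialHomeomorph X (EuclideanSpace ℝ (Fin 4)),
      p ∈ φ.source ∧ φ p = 0 ∧ ContMDiffOn (𝓡 4) (𝓡 4) ∞ φ φ.source ∧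
      ContMDiffOn (𝓡 4) (𝓡 4) ∞ φ.symm φ.target ∧
      (∀ q ∈ φ.source, (¬ Surjective (mfderiv (𝓡 4) (𝓡 2) f q) ↔
        (φ q) 1 = 0 ∧ (φ q) 2 = 0 ∧ (φ q) 3 = 0)) ∧
      InjOn f (φ.source ∩ {q | ¬ Surjective (mfderiv (𝓡 4) (𝓡 2) f q)}) := by
  obtain ⟨φ, ψ, hpφ, hφp, hmaps, hφ, hφs, hψ, hψs, hmodel⟩ := hf.fold p hp hpL
  refine ⟨φ, hpφ, hφp, hφ, hφs, fun q hq => ?_, injOn_of_foldChart hmaps hφ hφs hψ hψs hmodel⟩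
  rw [surjective_mfderiv_iff_of_foldChart hmaps hφ hφs hψ hψs hmodel hq, not_not]

end IsSimplifiedBrokenLefschetzFibration

end Literature.Topology.FourManifolds

end
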